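import Summits.QuantumAdvantage.QuantumAdvantage.Theses.ArithStatLadder
import Summits.QuantumAdvantage.QuantumAdvantage.Theorems.ArithStatLadderAvgFaceBeyondPriorUnitCubeMemBQP
import Summits.QuantumAdvantage.QuantumAdvantage.Theorems.ArithStatLadderAvgFaceBeyondPriorFactorBits
import Summits.QuantumAdvantage.QuantumAdvantage.Theorems.ArithStatLadderAvgFaceBeyondPriorCertUnitChecks
import Summits.QuantumAdvantage.QuantumAdvantage.Theorems.ArithStatLadderAvgFaceBeyondPriorCertUnitMemBQP

/-!
# Route `ArithStatLadder`, item `UnitCubeMemBQP` (stmt-QuantumAdvantage-15005)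

The support item of route `QuantumAdvantage/ArithStatLadder`: the unit-cube language

  `L_ε = bin {d : −d fundamental, d ≠ 3, UnitCubeAtThree d}`

is in `BQP` (the tree's strict class; the quantum witness of the GRH-free deciding shape M). The route
decl inlines `UnitCubeAtThree` (definitionally `Literature.NumberTheory.QuadraticFields.UnitCubeAtThree`, with
`mirrorRadicand`, `IsMirrorFundUnit`, `unitPow8` unfolded), so the item is closed by `exact` from the three
landed pieces of line `mirror-unit-signature` (crux `stmt-QuantumAdvantage-2427`):

* `Mirror.stub_unitCubeMemBQP : FB ∈ BQP → CU ∈ BQP → L_ε ∈ BQP` (the adaptive transducer with one joined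
  oracle, `BQP^BQP = BQP`, Bennett–Bernstein–Brassard–Vazirani 1997, Cor. 4.15;
  `Theorems/ArithStatLadderAvgFaceBeyondPriorUnitCubeMemBQP.lean`);
* `Mirror.factorBitsLang_mem_BQP : FB ∈ BQP` (Shor; `…FactorBits.lean`);
* `Mirror.certUnitLang_mem_BQP_of_guard : (poly-time guard) → CU ∈ BQP` (Hallgren 2007 regulator algorithm,
  no GRH, + Jacobson–Williams residues of the fundamental unit + the `(·)⁸ mod 9` test; `…CertUnitMemBQP.lean`)
  with the guard `Mirror.exists_goodFn` (`…CertUnitChecks.lean`).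

No named-fact hypothesis: every input is a proved tree theorem.
-/

set_option linter.dupNamespace false -- D-0017: single-problem summit ⇒ `QuantumAdvantage.QuantumAdvantage` by design

namespace Summit.QuantumAdvantage.QuantumAdvantage.Theorems.ArithStatLadder

/-- Settles `stmt-QuantumAdvantage-15005` (route ArithStatLadder, support `UnitCubeMemBQP`): the unit-cube
language `bin {d : −d fundamental, d ≠ 3, UnitCubeAtThree d}` is in `BQP` — factor bits (Shor) and the
certified unit language (Hallgren + Jacobson–Williams) in `BQP`, composed by the landed adaptive transducer
`Mirror.stub_unitCubeMemBQP`; the route's inlined unit predicate is definitionally `UnitCubeAtThree`.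
[cite: Hallgren2007] [cite: Jozsa2003, §10 Thm 7] [cite: JacobsonWilliams2008, Ch. 12] [cite: Shor1997, §5]
[cite: BennettBernsteinBrassardVazirani1997, Cor. 4.15] -/
theorem UnitCubeMemBQP_proof :
    Summit.QuantumAdvantage.QuantumAdvantage.Theses.ArithStatLadder.UnitCubeMemBQP := by
  unfold Summit.QuantumAdvantage.QuantumAdvantage.Theses.ArithStatLadder.UnitCubeMemBQP
  exact AvgFaceBeyondPrior.Mirror.stub_unitCubeMemBQP AvgFaceBeyondPrior.Mirror.factorBitsLang_mem_BQP
    (AvgFaceBeyondPrior.Mirror.certUnitLang_mem_BQP_of_guard AvgFaceBeyondPrior.Mirror.exists_goodFn)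

end Summit.QuantumAdvantage.QuantumAdvantage.Theorems.ArithStatLadder
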